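import Summits.FinalStateConjecture.FinalStateConjecture.Theorems.KerrShieldedDataExist.Negative.BentHeight
import Literature.Geometry.Lorentzian.KerrHyperboloidalFlux

/-!
# Crux `HonestFixedRadiusSettling` · line `sojourn-needs-only-one-over-delta` · stub `stub_farExit`
# Layer H1 (b): null vectors and Killing energy in the Kerr–Schild form

Helper file for `stmt-FinalStateConjecture-13550` (stub `stub_farExit`). Pointwise linear algebra of
the Kerr–Schild form `g = η + 2H ℓ ⊗ ℓ` (`Kerr.bilin M a x`, `0 ≤ M`, `r(x) > 0`) at ONE point:

* `ks_null_energy`: for a `g`-null vector `v`, `‖v⃗‖ ≤ |v⁰|` and the Killing energy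
  `E = −g(v, ∂₀) = v⁰ − 2H ℓ(v)` satisfies `|E − v⁰| ≤ 4H |v⁰|` (`ℓ(v) = v⁰ + ℓ⃗·v⃗`, `|ℓ⃗| = 1`);
* `ks_null_energy_far`: if moreover `H ≤ 1/16` and `E > 0` then `v⁰ > 0` and `3v⁰/4 ≤ E ≤ 5v⁰/4`;
* `ks_energy_pinning` (**the normalisation pins the energy**): if `n` is the `g`-unit future normal
  of a spacelike graph-type hyperplane `{(dh(q), q)}` with `‖dh‖ ≤ 1/6` through the point
  (`g(n, (dh q, q)) = 0`, `g(n, n) = −1`, `g(n, ∂₀) < 0`), and the null vector `w` is normalised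
  against it, `g(w, n) = −1`, with `E = −g(w, ∂₀) > 0`, then `E ≤ 5` (lapse and shift of the
  exact Kerr end over the far part of a bent Boyer–Lindquist slice are within `41/12` of those of
  Minkowski space; Cook, Living Rev. Relativ. 3 (2000), §3.2.2).

These feed the far-exit transport: with `H ≤ 1/16` on the exact flat zone the chart rate of a
normalised far null ray is `ż⁰ ≤ 2E ≤ 10`.

References: R. P. Kerr, A. Schild (1965), §2; M. Visser, arXiv:0706.0622, (32)–(35); G. B. Cook,
Living Rev. Relativ. 3 (2000) 5, §3.2.2; B. O'Neill, *Semi-Riemannian geometry* (1983), Ch. 5,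
Lemma 5.26 ff.
-/

set_option linter.dupNamespace false

noncomputable section

open Literature.Geometry.Lorentzian
open scoped Manifold ContDiff Topology RealInnerProductSpace
open Filter Set

namespace Summit.FinalStateConjecture.FinalStateConjecture.Theorems.StarvedNecks.OneOverDelta.FarEnd

/-! ## Component bookkeeping -/

/-- `η(v, w) = −v⁰w⁰ + ⟨v⃗, w⃗⟩`. [cite: ONeill1983, Ch. 3, p. 55] -/
theorem minkowski_apply_eq_inner (v w : E4) :
    Minkowski.bilin v w = -(v 0 * w 0) + ⟪E4.spatial v, E4.spatial w⟫ := by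
  rw [Minkowski.bilin_apply, PiLp.inner_apply]
  congr 1
  refine Finset.sum_congr rfl fun i _ ↦ ?_
  simp [E4.spatial_apply, mul_comm]

/-- `|⟨v⃗, w⃗⟩| ≤ ‖v⃗‖ ‖w⃗‖`. [folklore] -/
theorem abs_inner_spatial_le (v w : E4) :
    |⟪E4.spatial v, E4.spatial w⟫| ≤ E4.spatialNorm v * E4.spatialNorm w :=
  abs_real_inner_le_norm _ _

/-- `⟨v⃗, v⃗⟩ = ‖v⃗‖²`. [folklore] -/
theorem inner_spatial_self (v : E4) : ⟪E4.spatial v, E4.spatial v⟫ = E4.spatialNorm v ^ 2 := by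
  rw [E4.spatialNorm, real_inner_self_eq_norm_sq]

/-- **`ℓ(p) = p⁰ + ℓ⃗·p⃗` with `|ℓ⃗·p⃗| ≤ ‖p⃗‖`** (the spatial part of the Kerr–Schild null covector is a
Euclidean unit vector, `Kerr.sum_sq_nullCovectorFun`). [cite: arXiv07060622, (34)–(35)] -/
theorem abs_nullCovector_sub_le {a : ℝ} {x : E4} (hx : 0 < Kerr.radius a x) (p : E4) :
    |Kerr.nullCovector a x p - p 0| ≤ E4.spatialNorm p := by
  have hsum := Kerr.sum_sq_nullCovectorFun hx
  set l1 := Kerr.nullCovectorFun a x 1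
  set l2 := Kerr.nullCovectorFun a x 2
  set l3 := Kerr.nullCovectorFun a x 3
  have hl0 : Kerr.nullCovectorFun a x 0 = 1 := by simp [Kerr.nullCovectorFun]
  have hℓ : Kerr.nullCovector a x p - p 0 = l1 * p 1 + l2 * p 2 + l3 * p 3 := by
    simp only [Kerr.nullCovector, E4.covector_apply, Fin.sum_univ_four, hl0]
    ring
  have hN : E4.spatialNorm p ^ 2 = p 1 ^ 2 + p 2 ^ 2 + p 3 ^ 2 := E4.spatialNorm_sq p
  have hkey : (l1 * p 1 + l2 * p 2 + l3 * p 3) ^ 2 ≤ E4.spatialNorm p ^ 2 := by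
    rw [hN]
    nlinarith [sq_nonneg (l1 * p 2 - l2 * p 1), sq_nonneg (l1 * p 3 - l3 * p 1),
      sq_nonneg (l2 * p 3 - l3 * p 2)]
  rw [hℓ]
  exact abs_le_of_sq_le_sq' hkey (E4.spatialNorm_nonneg p) |> fun h ↦ abs_le.2 h

/-- The Kerr–Schild form against `∂₀`: `g(v, ∂₀) = −v⁰ + 2H ℓ(v)` (`η(v, ∂₀) = −v⁰`, `ℓ(∂₀) = 1`).
[cite: arXiv07060622, (32)–(34)] -/
theorem ks_apply_basisVector_zero (M a : ℝ) (x v : E4) :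
    Kerr.bilin M a x v (E4.basisVector 0) = -v 0 + 2 * Kerr.scalarH M a x * Kerr.nullCovector a x v := by
  have h0 : E4.spatial (E4.basisVector 0) = 0 := by ext i; simp
  rw [Kerr.bilin_apply, Kerr.nullCovector_basisVector_zero, minkowski_apply_eq_inner, h0, inner_zero_right]
  simp

/-- The Kerr–Schild form on the diagonal: `g(v, v) = −(v⁰)² + ‖v⃗‖² + 2H ℓ(v)²`.
[cite: arXiv07060622, (32)] -/
theorem ks_apply_self (M a : ℝ) (x v : E4) :
    Kerr.bilin M a x v v =
      -(v 0) ^ 2 + E4.spatialNorm v ^ 2 + 2 * Kerr.scalarH M a x * Kerr.nullCovector a x v ^ 2 := by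
  rw [Kerr.bilin_apply, minkowski_apply_eq_inner, inner_spatial_self]
  ring

/-- The Kerr–Schild form in general: `g(v, w) = −v⁰w⁰ + ⟨v⃗, w⃗⟩ + 2H ℓ(v) ℓ(w)`.
[cite: arXiv07060622, (32)] -/
theorem ks_apply (M a : ℝ) (x v w : E4) :
    Kerr.bilin M a x v w = -(v 0 * w 0) + ⟪E4.spatial v, E4.spatial w⟫ +
      2 * Kerr.scalarH M a x * (Kerr.nullCovector a x v * Kerr.nullCovector a x w) := by
  rw [Kerr.bilin_apply, minkowski_apply_eq_inner]

/-! ## Null vectors: spatial speed and Killing energy -/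

/-- **Null vectors of the Kerr–Schild form.** For `0 ≤ M`, `r(x) > 0` and `g(v, v) = 0`:
`‖v⃗‖ ≤ |v⁰|` (`‖v⃗‖² = (v⁰)² − 2Hℓ(v)²`, `H ≥ 0`) and the Killing energy `E = −g(v, ∂₀)` satisfies
`|E − v⁰| = 2H|ℓ(v)| ≤ 4H|v⁰|`. [cite: arXiv07060622, (32)–(35)] -/
theorem ks_null_energy {M a : ℝ} (hM : 0 ≤ M) {x : E4} (hx : 0 < Kerr.radius a x) {v : E4}
    (hnull : Kerr.bilin M a x v v = 0) :
    E4.spatialNorm v ≤ |v 0| ∧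
      |(-(Kerr.bilin M a x v (E4.basisVector 0))) - v 0| ≤ 4 * Kerr.scalarH M a x * |v 0| := by
  have hH : 0 ≤ Kerr.scalarH M a x := Kerr.scalarH_nonneg hM a x
  have hN0 : 0 ≤ E4.spatialNorm v := E4.spatialNorm_nonneg v
  have hℓ := abs_nullCovector_sub_le hx v
  set H := Kerr.scalarH M a x
  set N := E4.spatialNorm v
  set L := Kerr.nullCovector a x v
  rw [ks_apply_self] at hnull
  have hN2 : N ^ 2 ≤ v 0 ^ 2 := by nlinarith [sq_nonneg L]
  have hN : N ≤ |v 0| := by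
    rw [← sq_abs (v 0)] at hN2
    exact (sq_le_sq₀ hN0 (abs_nonneg _)).1 hN2
  refine ⟨hN, ?_⟩
  rw [ks_apply_basisVector_zero]
  have hL : |L| ≤ |v 0| + N := by
    have : L = (L - v 0) + v 0 := by ring
    rw [this]
    exact (abs_add_le _ _).trans (by linarith [hℓ])
  calc |(-(-v 0 + 2 * H * L)) - v 0| = 2 * H * |L| := by
        rw [show (-(-v 0 + 2 * H * L)) - v 0 = -(2 * H * L) by ring, abs_neg, abs_mul,
          abs_of_nonneg (by positivity : 0 ≤ 2 * H)]
    _ ≤ 2 * H * (|v 0| + N) := mul_le_mul_of_nonneg_left hL (by positivity)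
    _ ≤ 4 * H * |v 0| := by nlinarith

/-- **Far out, the Killing energy controls the chart rate of a null vector.** If moreover
`H(x) ≤ 1/16` and `E = −g(v, ∂₀) > 0`, then `v⁰ > 0`, `‖v⃗‖ ≤ v⁰` and `3v⁰/4 ≤ E ≤ 5v⁰/4`.
[cite: arXiv07060622, (32)–(35)] -/
theorem ks_null_energy_far {M a : ℝ} (hM : 0 ≤ M) {x : E4} (hx : 0 < Kerr.radius a x)
    (hH : Kerr.scalarH M a x ≤ 1 / 16) {v : E4} (hnull : Kerr.bilin M a x v v = 0)
    (hE : 0 < -(Kerr.bilin M a x v (E4.basisVector 0))) :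
    0 < v 0 ∧ E4.spatialNorm v ≤ v 0 ∧ 3 / 4 * v 0 ≤ -(Kerr.bilin M a x v (E4.basisVector 0)) ∧
      -(Kerr.bilin M a x v (E4.basisVector 0)) ≤ 5 / 4 * v 0 := by
  obtain ⟨hN, hEv⟩ := ks_null_energy hM hx hnull
  set E := -(Kerr.bilin M a x v (E4.basisVector 0))
  have h4 : 4 * Kerr.scalarH M a x * |v 0| ≤ |v 0| / 4 := by
    nlinarith [abs_nonneg (v 0)]
  have hEv' := abs_le.1 (hEv.trans h4)
  have hv0 : 0 < v 0 := by
    by_contra hcon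
    have : |v 0| = -v 0 := abs_of_nonpos (not_lt.1 hcon)
    rw [this] at hEv'
    linarith [hEv'.2]
  rw [abs_of_pos hv0] at hN hEv'
  exact ⟨hv0, hN, by linarith [hEv'.1], by linarith [hEv'.2]⟩

/-! ## The normalisation against the unit normal pins the energy -/

/-- **The unit future normal of a gently bent slice is close to `∂₀`.** Let `0 ≤ M`, `r(x) > 0`,
`H(x) ≤ 1/16`, `dh : E3 →L ℝ` with `‖dh‖ ≤ 1/6`. If `n` is `g`-normal to the graph directions
`(dh(q), q)`, `g(n, n) = −1` and `g(n, ∂₀) < 0`, then `n⁰ ≥ 1` and `41 ‖n⃗‖ ≤ 15 n⁰`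
(normality at `q = n⃗` bounds `‖n⃗‖²` by `(|n⁰|/6 + (7/48)(|n⁰| + ‖n⃗‖)) ‖n⃗‖`; unit length gives
`|n⁰| ≥ 1`; futureness gives the sign). [cite: Cook2000, §3.2.2] -/
theorem ks_normal_bounds {M a : ℝ} (hM : 0 ≤ M) {x : E4} (hx : 0 < Kerr.radius a x)
    (hH : Kerr.scalarH M a x ≤ 1 / 16) {dh : E3 →L[ℝ] ℝ} (hdh : ‖dh‖ ≤ 1 / 6) {n : E4}
    (hN1 : ∀ q : E3, Kerr.bilin M a x n (E4.ofTimeSpace (dh q) q) = 0)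
    (hN2 : Kerr.bilin M a x n n = -1) (hN3 : Kerr.bilin M a x n (E4.basisVector 0) < 0) :
    1 ≤ n 0 ∧ 41 * E4.spatialNorm n ≤ 15 * n 0 := by
  have hH0 : 0 ≤ Kerr.scalarH M a x := Kerr.scalarH_nonneg hM a x
  set H := Kerr.scalarH M a x with hH_def
  set Nn := E4.spatialNorm n with hNn_def
  have hNn0 : 0 ≤ Nn := E4.spatialNorm_nonneg n
  set sn := Kerr.nullCovector a x n - n 0 with hsn_def
  have hsn : |sn| ≤ Nn := abs_nullCovector_sub_le hx n
  have hLn : Kerr.nullCovector a x n = n 0 + sn := by rw [hsn_def]; ring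
  -- (N1) at `q = n⃗`
  have hq := hN1 (E4.spatial n)
  set q := E4.spatial n with hq_def
  set p := E4.ofTimeSpace (dh q) q with hp_def
  have hp0 : p 0 = dh q := E4.ofTimeSpace_apply_zero _ _
  have hpsp : E4.spatial p = q := E4.spatial_ofTimeSpace _ _
  have hdhq : |dh q| ≤ Nn / 6 := by
    have h1 := dh.le_opNorm q
    rw [Real.norm_eq_abs] at h1
    have h2 : ‖dh‖ * ‖q‖ ≤ 1 / 6 * ‖q‖ := mul_le_mul_of_nonneg_right hdh (norm_nonneg q)
    have : ‖q‖ = Nn := rfl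
    linarith
  set sp := Kerr.nullCovector a x p - p 0 with hsp_def
  have hsp : |sp| ≤ Nn := by
    have := abs_nullCovector_sub_le hx p
    rwa [E4.spatialNorm, hpsp] at this
  have hLp : Kerr.nullCovector a x p = dh q + sp := by rw [hsp_def, hp0]; ring
  rw [ks_apply, hpsp, inner_spatial_self, hp0, hLn, hLp] at hq
  -- `Nn² = n0 dh q − 2H (n0 + sn)(dh q + sp)`, whence `41 Nn ≤ 15 |n0|`
  have hNn_le : 41 * Nn ≤ 15 * |n 0| := by
    have habs1 : |n 0 * dh q| ≤ |n 0| * (Nn / 6) := by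
      rw [abs_mul]; exact mul_le_mul_of_nonneg_left hdhq (abs_nonneg _)
    have hf1 : |n 0 + sn| ≤ |n 0| + Nn := (abs_add_le _ _).trans (by linarith)
    have hf2 : |dh q + sp| ≤ Nn / 6 + Nn := (abs_add_le _ _).trans (by linarith)
    have habs2 : |2 * H * ((n 0 + sn) * (dh q + sp))| ≤ 2 * H * ((|n 0| + Nn) * (Nn / 6 + Nn)) := by
      rw [abs_mul, abs_of_nonneg (by linarith : (0 : ℝ) ≤ 2 * H), abs_mul]
      exact mul_le_mul_of_nonneg_left
        (mul_le_mul hf1 hf2 (abs_nonneg _) (by linarith [abs_nonneg (n 0)])) (by linarith)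
    have hH8 : 2 * H * ((|n 0| + Nn) * (Nn / 6 + Nn)) ≤ 1 / 8 * ((|n 0| + Nn) * (Nn / 6 + Nn)) :=
      mul_le_mul_of_nonneg_right (by linarith)
        (mul_nonneg (by linarith [abs_nonneg (n 0)]) (by linarith))
    have h2 : Nn ^ 2 ≤ |n 0| * (Nn / 6) + 1 / 8 * ((|n 0| + Nn) * (Nn / 6 + Nn)) := by
      have e : Nn ^ 2 = n 0 * dh q - 2 * H * ((n 0 + sn) * (dh q + sp)) := by linarith
      have l1 := le_abs_self (n 0 * dh q)
      have l2 := neg_abs_le (2 * H * ((n 0 + sn) * (dh q + sp)))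
      linarith
    have h3 : Nn * (41 * Nn - 15 * |n 0|) ≤ 0 := by nlinarith [h2]
    rcases hNn0.eq_or_lt with h0 | hpos
    · rw [← h0]; linarith [abs_nonneg (n 0)]
    · by_contra hc
      have : 0 < Nn * (41 * Nn - 15 * |n 0|) := mul_pos hpos (by linarith)
      linarith
  -- (N2): `|n⁰| ≥ 1`
  rw [ks_apply_self, hLn] at hN2
  have hn0abs : 1 ≤ |n 0| := by
    have hpos : 0 ≤ 2 * H * (n 0 + sn) ^ 2 := mul_nonneg (by linarith) (sq_nonneg _)
    have h1 : 1 ≤ (n 0) ^ 2 := by nlinarith [sq_nonneg Nn]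
    exact (one_le_sq_iff_one_le_abs _).1 h1
  -- (N3): `n⁰ > 0`
  rw [ks_apply_basisVector_zero, hLn] at hN3
  have habsH : |2 * H * (n 0 + sn)| ≤ 1 / 8 * (|n 0| + Nn) := by
    rw [abs_mul, abs_of_nonneg (by linarith : (0 : ℝ) ≤ 2 * H)]
    exact mul_le_mul (by linarith) ((abs_add_le _ _).trans (by linarith)) (abs_nonneg _)
      (by norm_num)
  have hn0 : 0 < n 0 := by
    by_contra hcon
    have habs : |n 0| = -n 0 := abs_of_nonpos (not_lt.1 hcon)
    have h2 := neg_abs_le (2 * H * (n 0 + sn))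
    rw [habs] at habsH hNn_le hn0abs
    linarith
  rw [abs_of_pos hn0] at hNn_le hn0abs
  exact ⟨hn0abs, hNn_le⟩

/-- **The normalisation pins the Killing energy.** In the setting of `ks_normal_bounds`, if `w` is
`g`-null, normalised against the unit normal by `g(w, n) = −1`, with positive Killing energy
`E = −g(w, ∂₀)`, then `E ≤ 5`: `g(w, n) = −1` reads `w⁰ n⁰ = 1 + ⟨w⃗, n⃗⟩ + 2H ℓ(w) ℓ(n)`, and
`‖w⃗‖ ≤ w⁰`, `‖n⃗‖ ≤ (15/41) n⁰`, `H ≤ 1/16` give `(12/41) w⁰ n⁰ ≤ 1`, `w⁰ ≤ 41/12`, `E ≤ 5w⁰/4`.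
[cite: Cook2000, §3.2.2] -/
theorem ks_energy_pinning {M a : ℝ} (hM : 0 ≤ M) {x : E4} (hx : 0 < Kerr.radius a x)
    (hH : Kerr.scalarH M a x ≤ 1 / 16) {dh : E3 →L[ℝ] ℝ} (hdh : ‖dh‖ ≤ 1 / 6) {n w : E4}
    (hN1 : ∀ q : E3, Kerr.bilin M a x n (E4.ofTimeSpace (dh q) q) = 0)
    (hN2 : Kerr.bilin M a x n n = -1) (hN3 : Kerr.bilin M a x n (E4.basisVector 0) < 0)
    (hW1 : Kerr.bilin M a x w w = 0) (hW2 : Kerr.bilin M a x w n = -1)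
    (hE : 0 < -(Kerr.bilin M a x w (E4.basisVector 0))) :
    -(Kerr.bilin M a x w (E4.basisVector 0)) ≤ 5 := by
  obtain ⟨hn0, hNn⟩ := ks_normal_bounds hM hx hH hdh hN1 hN2 hN3
  obtain ⟨hw0, hNw, -, hEw⟩ := ks_null_energy_far hM hx hH hW1 hE
  have hH0 : 0 ≤ Kerr.scalarH M a x := Kerr.scalarH_nonneg hM a x
  set H := Kerr.scalarH M a x with hH_def
  set Nn := E4.spatialNorm n with hNn_def
  set Nw := E4.spatialNorm w with hNw_def
  have hNn0 : 0 ≤ Nn := E4.spatialNorm_nonneg n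
  have hNw0 : 0 ≤ Nw := E4.spatialNorm_nonneg w
  set sn := Kerr.nullCovector a x n - n 0 with hsn_def
  have hsn : |sn| ≤ Nn := abs_nullCovector_sub_le hx n
  have hLn : Kerr.nullCovector a x n = n 0 + sn := by rw [hsn_def]; ring
  set sw := Kerr.nullCovector a x w - w 0 with hsw_def
  have hsw : |sw| ≤ Nw := abs_nullCovector_sub_le hx w
  have hLw : Kerr.nullCovector a x w = w 0 + sw := by rw [hsw_def]; ring
  rw [ks_apply, hLw, hLn] at hW2
  have hinner : |⟪E4.spatial w, E4.spatial n⟫| ≤ Nw * Nn := abs_inner_spatial_le w n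
  have h1 : |w 0 + sw| ≤ w 0 + Nw := (abs_add_le _ _).trans (by rw [abs_of_pos hw0]; linarith)
  have h2 : |n 0 + sn| ≤ n 0 + Nn :=
    (abs_add_le _ _).trans (by rw [abs_of_pos (by linarith : 0 < n 0)]; linarith)
  have hprod : |2 * H * ((w 0 + sw) * (n 0 + sn))| ≤ 1 / 8 * ((w 0 + Nw) * (n 0 + Nn)) := by
    rw [abs_mul, abs_of_nonneg (by linarith : (0 : ℝ) ≤ 2 * H), abs_mul]
    exact mul_le_mul (by linarith) (mul_le_mul h1 h2 (abs_nonneg _) (by linarith))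
      (mul_nonneg (abs_nonneg _) (abs_nonneg _)) (by norm_num)
  have e1 : w 0 * n 0 = 1 + ⟪E4.spatial w, E4.spatial n⟫ + 2 * H * ((w 0 + sw) * (n 0 + sn)) := by
    linarith
  have l1 := le_abs_self ⟪E4.spatial w, E4.spatial n⟫
  have l2 := le_abs_self (2 * H * ((w 0 + sw) * (n 0 + sn)))
  have hkey : w 0 * n 0 ≤ 1 + Nw * Nn + 1 / 8 * ((w 0 + Nw) * (n 0 + Nn)) := by linarith
  have hA : Nw * Nn ≤ w 0 * (15 / 41 * n 0) := mul_le_mul hNw (by linarith) hNn0 hw0.le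
  have hB : (w 0 + Nw) * (n 0 + Nn) ≤ (2 * w 0) * (56 / 41 * n 0) :=
    mul_le_mul (by linarith) (by linarith) (by linarith) (by linarith)
  have hC : 12 * (w 0 * n 0) ≤ 41 := by linarith
  have hD : w 0 ≤ w 0 * n 0 := by nlinarith
  linarith

/-- **Deciding theorem of this helper file (registered stub `farExit_energy_pinning`)**: the
normalisation pins the Killing energy, `ks_energy_pinning` with explicit binders.
[cite: Cook2000, §3.2.2] -/
theorem farExit_energy_pinning : ∀ (M a : ℝ) (x : E4) (dh : E3 →L[ℝ] ℝ) (n w : E4), 0 ≤ M → 0 < Kerr.radius a x → Kerr.scalarH M a x ≤ 1 / 16 → ‖dh‖ ≤ 1 / 6 → (∀ q : E3, Kerr.bilin M a x n (E4.ofTimeSpace (dh q) q) = 0) → Kerr.bilin M a x n n = -1 → Kerr.bilin M a x n (E4.basisVector 0) < 0 → Kerr.bilin M a x w w = 0 → Kerr.bilin M a x w n = -1 → 0 < -(Kerr.bilin M a x w (E4.basisVector 0)) → -(Kerr.bilin M a x w (E4.basisVector 0)) ≤ 5 :=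
  fun _ _ _ _ _ _ hM hx hH hdh hN1 hN2 hN3 hW1 hW2 hE ↦ ks_energy_pinning hM hx hH hdh hN1 hN2 hN3 hW1 hW2 hE

end Summit.FinalStateConjecture.FinalStateConjecture.Theorems.StarvedNecks.OneOverDelta.FarEnd

end
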